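/-
Copyright (c) 2026. All rights reserved.
Released under Apache 2.0 license as described in the file LICENSE.
Authors: hodgecm-mathlib cell (D-0151), fan A, seat A-p10.
-/
import Literature.NumberTheory.Automorphic.UnitaryGroupArchimedean
import Literature.NumberTheory.Automorphic.QuadExtTotallyComplexPlaces
import Mathlib.NumberTheory.NumberField.InfinitePlace.TotallyRealComplex
import HarnessLib

/-!
# `U(H)(E ⊗ ℝ)` is compact for `E/F` totally complex over totally real and `H` definite — and always for rank one

Topic `NumberTheory/Automorphic`; namespace `Literature.NumberTheory.Automorphic.UnitaryGroup` (continues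
`UnitaryGroupArchimedean` §4 and `QuadExtTotallyComplexPlaces` §1, SAME SPELLING: the archimedean points
`arch F E c N H ≤ GL_N(E ⊗_ℚ ℝ)` of the unitary group of `H ∈ M_N(E)` for a quadratic extension of number fields `E/F` with
involution `c`).  KERNEL ONLY: theorems over the tree's ★ lemmas and Mathlib; no definition, no named fact, no instance, no `sorry`.

THE PRINT. [PlatonovRapinchuk1994, §2.3, §3.2 (Thm 3.1 ff.)]: for `F` TOTALLY REAL and `E` TOTALLY COMPLEX every archimedean place `v` of
`F` is real and does not split in `E` (`E_v = ℂ`, the place `w ∣ v` of `E` is complex and fixed by `c`), so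
`U(H)(E ⊗_ℚ ℝ) = ∏_{v ∣ ∞} U(σ_w(H))` is a product of honest unitary groups of the hermitian matrices `σ_w(H) ∈ M_N(ℂ)`, and it is
COMPACT as soon as every `σ_w(H)` is definite (a closed subgroup of `∏ U(N)`).  In RANK ONE, `H = (t)` with `t ∈ F×`, every
`σ_w(t) = σ_v(t)` is a NON-ZERO REAL number (`σ_w ∘ (F ↪ E)` is a real embedding of the totally real `F`), hence `(t)` is definite of
one sign or the other at every place and `U(t)(E ⊗ ℝ) = ∏_{v ∣ ∞} U(1)` is compact — with no hypothesis beyond `t ≠ 0`.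

* §1 `smul_infinitePlace_of_isTotallyReal` — `c • w = w` for every infinite place `w` of `E` (★ `smul_eq_of_isComplex_of_isReal_comap`);
  **`isCompact_arch_of_isTotallyReal`** / **`compactSpace_arch_of_isTotallyReal`** — ★ `isCompact_arch` with that `hfix`;
* §2 `posDef_or_neg_posDef_map_rankOne` — `σ_w((t))` is `PosDef` or `(-·).PosDef` for `t ∈ F×`;
  **`isCompact_arch_rankOne`** / **`compactSpace_arch_rankOne`** — `U(J_W)(E ⊗ ℝ)` is compact for `J_W = (t)`, `t = T_W ∈ F×`, in
  EXACTLY the binder letters of `Li1992.KernelRallisIdentityUnitaryRankOneCM` (`(F E) (c) (JW) {TW} [IsQuadraticExtension F E]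
  [IsTotallyReal F] [IsTotallyComplex E] {δ} (hcδ : c δ = -δ) (hδ : δ ≠ 0) (hWd : IsUnit TW.det) (hJW : JW = TW.map (algebraMap F E))`),
  so a consumer discharges `[CompactSpace (UnitaryGroup.arch F E c 1 JW)]` by
  `haveI := UnitaryGroup.compactSpace_arch_rankOne F E c JW hcδ hδ hWd hJW`.

USE (cell `hodgecm-mathlib`, FLOOR-0 P4, ENGINE E-2 child `Cruxes/H413/Lines/F0_E2SiegelWeilWeilRange.lean`, `stub_SW2_siegelWeil`, road (W),
row ARCH-CPT of F0P4-plan (g3) 02:17:28Z): discharges the instance hypothesis `[CompactSpace (UnitaryGroup.arch F E c 1 JW)]` of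
`Theorems/H413E2SW2OrbitalSumsReduction.orbitalSums_bounded_of_finIntegrable` (F0P2a-p06) from the CM structure binders of the L1 letter.
HC_CM is proved only modulo the printed citations until rung 0 closes.

## References
* [PlatonovRapinchuk1994] V. Platonov, A. Rapinchuk, *Algebraic Groups and Number Theory* (1994), §2.3 (archimedean places in a
  quadratic extension), §3.2 Thm 3.1 ff. (the real points of the unitary group of a definite hermitian form are compact).
* [BorelJacquet1979] A. Borel, H. Jacquet, *Automorphic forms and automorphic representations*, Proc. Symp. Pure Math. 33.1 (1979), §4.1.
-/

set_option autoImplicit false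

noncomputable section

open NumberField NumberField.InfinitePlace NumberField.mixedEmbedding
open scoped Matrix MatrixGroups ComplexOrder

namespace Literature.NumberTheory.Automorphic

namespace UnitaryGroup

variable (F E : Type) [Field F] [NumberField F] [Field E] [NumberField E] [Algebra F E] (c : E ≃ₐ[F] E)

/-! ## §1 `F` totally real, `E` totally complex: every infinite place of `E` is `c`-fixed, so definite `H` gives compact `U(H)(E ⊗ ℝ)` -/

section TotallyReal

variable [Algebra.IsQuadraticExtension F E] [IsTotallyReal F] [IsTotallyComplex E]

/-- **every infinite place of a totally complex quadratic extension `E` of a totally real `F` is fixed by the involution**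
(it is complex over a real place, hence ramified: ★ `smul_eq_of_isComplex_of_isReal_comap`). [cite: PlatonovRapinchuk1994, §2.3] -/
theorem smul_infinitePlace_of_isTotallyReal (w : InfinitePlace E) : c • w = w :=
  smul_eq_of_isComplex_of_isReal_comap F E c w (IsTotallyComplex.isComplex w) (IsTotallyReal.isReal _)

/-- **`U(H)(E ⊗_ℚ ℝ)` is compact** for `E/F` totally complex over totally real, `c ≠ 1`, and `H ∈ M_N(E)` definite (of either
sign) at every complex place of `E` — ★ `isCompact_arch` with `hfix := smul_infinitePlace_of_isTotallyReal`.
[cite: PlatonovRapinchuk1994, §3.2 Thm 3.1] -/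
theorem isCompact_arch_of_isTotallyReal (N : ℕ) (H : Matrix (Fin N) (Fin N) E) (hc : c ≠ 1)
    (hdef : ∀ w : {w : InfinitePlace E // IsComplex w},
      (H.map w.1.embedding).PosDef ∨ (-H.map w.1.embedding).PosDef) :
    IsCompact (arch F E c N H : Set (GL (Fin N) (mixedSpace E))) :=
  isCompact_arch F E c N H hc (smul_infinitePlace_of_isTotallyReal F E c) hdef

/-- the same, as a `CompactSpace` instance term for the subgroup type `↥(arch F E c N H)` (`isCompact_iff_compactSpace`).
[cite: PlatonovRapinchuk1994, §3.2 Thm 3.1] -/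
theorem compactSpace_arch_of_isTotallyReal (N : ℕ) (H : Matrix (Fin N) (Fin N) E) (hc : c ≠ 1)
    (hdef : ∀ w : {w : InfinitePlace E // IsComplex w},
      (H.map w.1.embedding).PosDef ∨ (-H.map w.1.embedding).PosDef) :
    CompactSpace (arch F E c N H) :=
  isCompact_iff_compactSpace.mp (isCompact_arch_of_isTotallyReal F E c N H hc hdef)

end TotallyReal

/-! ## §2 Rank one: `U(t)(E ⊗ ℝ) = ∏_{v ∣ ∞} U(1)` is compact for every `t ∈ F×` -/

section RankOne

variable (JW : Matrix (Fin 1) (Fin 1) E) {TW : Matrix (Fin 1) (Fin 1) F}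

omit [NumberField F] in
/-- `c δ = -δ` with `δ ≠ 0` forces `c ≠ 1` (characteristic zero). [folklore] -/
private theorem ne_one_of_apply_eq_neg {δ : E} (hcδ : c δ = -δ) (hδ : δ ≠ 0) : c ≠ 1 := by
  intro h1
  apply hδ
  have h2 : (2 : E) * δ = 0 := by
    have hδδ : δ = -δ := by simpa [h1] using hcδ
    linear_combination hδδ
  exact (mul_eq_zero.1 h2).resolve_left two_ne_zero

/-- a `1 × 1` matrix is the diagonal matrix of its entry. [folklore] -/
private theorem eq_diagonal_fin_one {R : Type*} [Zero R] (M : Matrix (Fin 1) (Fin 1) R) :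
    M = Matrix.diagonal fun _ => M 0 0 := by
  ext i j
  rw [Subsingleton.elim i 0, Subsingleton.elim j 0, Matrix.diagonal_apply_eq]

omit [NumberField F] [NumberField E] in
/-- **at every complex place `w` of `E`, `σ_w(J_W)` is definite of one sign or the other** for `J_W = (t)`, `t = T_W ∈ F×`, `F`
totally real: `σ_w(t) = σ_v(t)` is a non-zero REAL number (`σ_w ∘ (F ↪ E)` is a real embedding, Mathlib
`IsTotallyReal.complexEmbedding_isReal`), and a `1 × 1` real matrix `(r)`, `r ≠ 0`, is `PosDef` or `(-·).PosDef`
(`Matrix.posDef_diagonal_iff`). [cite: PlatonovRapinchuk1994, §2.3] -/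
theorem posDef_or_neg_posDef_map_rankOne [IsTotallyReal F] (hWd : IsUnit TW.det) (hJW : JW = TW.map (algebraMap F E))
    (w : {w : InfinitePlace E // IsComplex w}) :
    (JW.map w.1.embedding).PosDef ∨ (-JW.map w.1.embedding).PosDef := by
  -- the entry `σ_w(t)` is the real number `r := ρ(t)` for the real embedding `ρ` underlying `σ_w ∘ (F ↪ E)`
  have hφ : ComplexEmbedding.IsReal (w.1.embedding.comp (algebraMap F E)) :=
    IsTotallyReal.complexEmbedding_isReal _
  set r : ℝ := hφ.embedding (TW 0 0) with hr
  have ht : TW 0 0 ≠ 0 := by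
    have h := hWd.ne_zero
    rwa [Matrix.det_fin_one] at h
  have hr0 : r ≠ 0 := (map_ne_zero hφ.embedding).2 ht
  have hentry : (JW.map w.1.embedding) 0 0 = (r : ℂ) := by
    rw [hJW, Matrix.map_apply, Matrix.map_apply, hr, ComplexEmbedding.IsReal.coe_embedding_apply]; rfl
  have hM : JW.map w.1.embedding = Matrix.diagonal fun _ : Fin 1 => (r : ℂ) := by
    rw [eq_diagonal_fin_one (JW.map w.1.embedding), hentry]
  rw [hM, Matrix.diagonal_neg]
  rcases lt_or_lt_iff_ne.2 hr0 with h | h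
  · refine Or.inr (Matrix.posDef_diagonal_iff.2 fun _ => ?_)
    rw [← Complex.ofReal_neg]
    exact Complex.zero_lt_real.2 (neg_pos.2 h)
  · exact Or.inl (Matrix.posDef_diagonal_iff.2 fun _ => Complex.zero_lt_real.2 h)

variable [Algebra.IsQuadraticExtension F E] [IsTotallyReal F] [IsTotallyComplex E]

/-- **`U(J_W)(E ⊗_ℚ ℝ)` is compact in rank one** — `J_W = (t)`, `t = T_W ∈ F×`, `E/F` totally complex over totally real with
involution `c` (`c δ = -δ`, `δ ≠ 0`): `∏_{v ∣ ∞} U(1)`.  Binder letters of `Li1992.KernelRallisIdentityUnitaryRankOneCM`.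
[cite: PlatonovRapinchuk1994, §3.2 Thm 3.1] -/
theorem isCompact_arch_rankOne {δ : E} (hcδ : c δ = -δ) (hδ : δ ≠ 0) (hWd : IsUnit TW.det)
    (hJW : JW = TW.map (algebraMap F E)) :
    IsCompact (arch F E c 1 JW : Set (GL (Fin 1) (mixedSpace E))) :=
  isCompact_arch_of_isTotallyReal F E c 1 JW (ne_one_of_apply_eq_neg F E c hcδ hδ)
    (posDef_or_neg_posDef_map_rankOne F E JW hWd hJW)

/-- **`CompactSpace ↥(arch F E c 1 J_W)`** — the instance term a consumer installs with
`haveI := UnitaryGroup.compactSpace_arch_rankOne F E c JW hcδ hδ hWd hJW`. [cite: PlatonovRapinchuk1994, §3.2 Thm 3.1] -/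
theorem compactSpace_arch_rankOne {δ : E} (hcδ : c δ = -δ) (hδ : δ ≠ 0) (hWd : IsUnit TW.det)
    (hJW : JW = TW.map (algebraMap F E)) : CompactSpace (arch F E c 1 JW) :=
  isCompact_iff_compactSpace.mp (isCompact_arch_rankOne F E c JW hcδ hδ hWd hJW)

end RankOne

end UnitaryGroup

end Literature.NumberTheory.Automorphic

end
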